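import Summits.QuantumFields.YangMills.Theorems.FluctuationComparisonRegPrIntLPolymerNormKnit
import Literature.MathematicalPhysics.QuantumFieldTheory.Balaban1983to89.B12Decay510Torus
import HarnessLib

/-!
# THE LATTICE-ANIMAL EDITION OF THE POLYMER FORM: PER-POLYMER TREE DECAY ⇒ THE POLYMER-NORM CLAUSE, BY (1.26) (texts inline, def-free)

Cell `ym3-torus` (YM ladder rung R3 = continuum `SU(2)` Yang–Mills on the three-torus — a RUNG, NOT d = 4, NOT infinite volume, NOT a mass gap, NOT Clay).  Width seat
`ym-ust-20520-w3` (gen 20, LEAD-20520 by lineage); `--supports stmt-QuantumFields-20520 --as helper`, count-neutral, definition-free, default heartbeats.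

WHAT.  ✓`…PolymerNormKnit` reduced the PATH-B organ S2β `FluctuationPartSmall` (and GRAD∘) to ideator g24-3's print-shaped row POLY∘ and further to its polymer-norm
edition POLYⁿ∘ (ONE weighted one-pin clause `Σ_{X ∋ b} w X·e^{κ·tdiam X} ≤ φ_J`).  Print states its bounds PER TERM — [Balaban1987RG1] (0.25) p.257
«`|E^{(j)}(X,U)| ≤ E₀ exp(−κ d_j(X))`», [Balaban1989LargeFieldII] (1.100) p.390 — over LOCALIZATION DOMAINS `X` = face-connected unions of `M`-cubes of the current lattice,
`d_j(X)` the tree length in cube units, and sums them by the LATTICE-ANIMAL bound [Balaban1988RG2Cluster] (1.26) p.8 `Σ_{X ∋ □} exp(−κ d_j(X)) ≤ K₀` (κ ≥ κ₀), which the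
tree holds on every torus (lit ✓`TreeLengthTorus.sum_exp_torusTreeLen_le`, constants `B12TreeDecay.kappa₀ ∕ K₀`).  This file types that per-term edition as the row **POLYᵗ∘**
and proves POLYᵗ∘ → POLYⁿ∘ (hence → POLY∘ → S2β ∕ GRAD∘):
* **POLYᵗ∘** (inline; the binder `hT` of §2): S2β's frame; `∃ M` (cube side, `NeZero`) and `∃ κ`, `0 < κ`, `2·κ₀(4·2³, 2·3) ≤ κ` BEFORE `∀ F γ`; `∃ A : ℕ → ℝ≥0` super-polynomial
  AFTER; then for every run `K ≥ J` and window version `ρ`: a cube torus `TPt 3 N` with an identification `e : Site (F.P J) 0 ≃ TPt 3 (N·M)` that is an ISOMETRY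
  `tdist x y = pl1 (e x − e y)` (§1 supplies the canonical one whenever `M ∣ 2L^{m+J}`), a constant `c₀` and LOCAL TERMS `T Y` indexed by cube polymers
  `Y : Finset (TPt 3 N)` with (i) `T Y U` depends only on the bonds whose source cube `tcubeOf N M (e b.src)` lies in `Y`; (ii) `T Y = 0` unless `Y` is torus-face-connected;
  (iii) PER-POLYMER ONE-BOND WINDOW OSCILLATION `|T Y U − T Y V| ≤ A_J · exp(−κ · torusTreeLen Y)` for window `U, V` agreeing off one bond (print's per-direction Schwarz bound; v2 of LINE g24-3, idea-crit-5 #476-P2); (iv) `log ρ + β_K·𝔄^reg = c₀ + Σ_Y T Y` on the window.  (Single scale: terms born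
  at finer levels are re-localized into the current `M`-cube domains, as print does at every step — [Balaban1988RG2Cluster] (2.29) p.18.)
* §1 `natAbs_valMinAbs_eq_min_val`, ★`exists_siteEquiv_pl1` — the dictionary `Site (F.P J) 0 ≃ TPt 3 (N·M)` (componentwise
  `ZMod.ringEquivCongr`), `val`-preserving and an isometry `tdist = pl1`, for every factorisation `(F.P J).sitesPerDir 0 = N·M`.
* §2 ★★★ `polymerNormCan_of_polymerTree : ⟨POLYᵗ∘⟩ → ⟨POLYⁿ∘ VERBATIM⟩` with `κⁿ := κ∕(2·M·3)`, `φ_J := A_J · e^{3κ∕2} · K₀(4·2³, 2·3)`: group the cube terms by their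
  bond set `bs Y := {b | tcubeOf N M (e b.src) ∈ Y}` (`Finset.sum_fiberwise`), bound `tdiam (bs Y) ≤ 3M·(torusTreeLen Y + 3)` by lit ✓`B12Decay510Torus.pl1_sub_le_torusTreeLen_sites`,
  split `e^{−κ d} · e^{κⁿ·3M(d+3)} = e^{3κ∕2} · e^{−(κ∕2) d}` and resum by ✓`sum_exp_torusTreeLen_le` at rate `κ∕2 ≥ κ₀`.
* §3 ★★★ `fluctuationPartSmall_of_polymerTree : ⟨POLYᵗ∘⟩ → ⟨S2β VERBATIM⟩`, `oneBondOscillation_of_polymerTree : ⟨POLYᵗ∘⟩ → ⟨GRAD∘ VERBATIM⟩` (compositions with ✓`…PolymerNormKnit`).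

NET FOR THE CENSUS.  LINE g24-3's cone: POLYᵗ∘ → POLYⁿ∘ → POLY∘ → S2β, all junctions in `Theorems/`; POLYᵗ∘ is print's (0.25)∕(1.100) currency literally (per-domain exponential
tree decay, one scale), the lattice-animal resummation DISCHARGED by the tree.  CREDITS NOTHING: POLYᵗ∘ is an XL+ letter (RG1–RG2–LF-I–LF-II's output representation for the T³
scheme re-localized to one scale + the last Mayer step + the Schwarz corollary); registry v11.4 0∕5 unchanged.

HONEST SCOPE.  Lattice geometry + finite sums over landed lit lemmas; nothing of Bałaban's analytic content is asserted or proved; POLYᵗ∘ ∕ POLYⁿ∘ ∕ POLY∘ ∕ S2β ∕ GRAD∘ ∕ the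
five registered ∘-rows ∕ `FluctuationComparisonRegPrIntL` (20520) NOT proved; no summit is proved by a helper; rung R3 = SU(2) YM₃ on T³ — NOT d = 4, NOT infinite volume, NOT
a mass gap, NOT Clay.  Sorry-free, axioms standard.

References: T. Bałaban, CMP **109** (1987) 249–301 [Balaban1987RG1] (Thm 1 p.259; (0.24)–(0.25) p.257; §0 p.257 cubes of size M); CMP **116** (1988) 1–22
[Balaban1988RG2Cluster] ((1.26) p.8, (2.29) p.18); CMP **122** (1989) 355–392 [Balaban1989LargeFieldII] ((1.98)–(1.100) p.390); CMP **102** (1985) 255–275 [Balaban1985UV3]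
(Thm 2 p.263, (41) p.266).
-/

set_option autoImplicit false

noncomputable section

namespace Summit.QuantumFields.YangMills.Theorems.FluctuationComparisonRegPrIntLPolymerTreeKnit

open MeasureTheory Filter Topology Set
open scoped BigOperators
open Literature.MathematicalPhysics.QuantumFieldTheory.Balaban1983to89
open Literature.MathematicalPhysics.QuantumFieldTheory.Balaban1983to89.T3ContinuumYM3Torus
open Literature.MathematicalPhysics.QuantumFieldTheory.Balaban1983to89.T3NestedUnitLaws
open Literature.MathematicalPhysics.QuantumFieldTheory.Balaban1983to89.T3UnitLawDensityEML
open Literature.MathematicalPhysics.QuantumFieldTheory.Balaban1983to89.T3UnitScaleTilt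
open Literature.MathematicalPhysics.QuantumFieldTheory.Balaban1983to89.T3TiltDescent
open Literature.MathematicalPhysics.QuantumFieldTheory.Balaban1983to89.T3PrintedRegularMinimiser
open Literature.MathematicalPhysics.QuantumFieldTheory.Balaban1983to89.T3LevelShift
open Literature.MathematicalPhysics.QuantumFieldTheory.Balaban1983to89.Missing
open Literature.MathematicalPhysics.QuantumFieldTheory.Balaban1983to89.T4Continuum
open Literature.MathematicalPhysics.QuantumFieldTheory.Balaban1983to89.TreeLengthTorus (TPt TFaceConnected torusTreeLen sum_exp_torusTreeLen_le)
open Literature.MathematicalPhysics.QuantumFieldTheory.Balaban1983to89.B12TreeDecay (kappa₀ K₀ kappa₀_nonneg K₀_pos)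
open Literature.MathematicalPhysics.QuantumFieldTheory.Balaban1983to89.B12Decay510Torus (pabs pl1 pl1_eq_sum pabs_eq_natAbs tcubeOf pl1_sub_le_torusTreeLen_sites)
open Summit.QuantumFields.YangMills.Theorems.FluctuationComparisonRegPrIntLPolymerNormKnit

/-! ## §1 The dictionary: the level-`J` site torus as `TPt 3 (N·M)`, isometrically -/

/-- `|valMinAbs z| = min (val z) (val (−z))` on `ZMod n`, `n ≠ 0`. [folklore] -/
theorem natAbs_valMinAbs_eq_min_val {n : ℕ} [NeZero n] (z : ZMod n) : z.valMinAbs.natAbs = min z.val (-z).val := by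
  rw [ZMod.valMinAbs_natAbs_eq_min, ZMod.neg_val]
  split_ifs with h
  · subst h; simp
  · rfl

/-- ★ **THE CANONICAL IDENTIFICATION OF THE LEVEL-`J` SITE TORUS WITH `TPt 3 (N·M)`** for any factorisation `(F.P J).sitesPerDir 0 = N·M` of the number of sites per
direction: componentwise `ZMod.ringEquivCongr`; it preserves `val` (so `tcubeOf N M ∘ e` IS the cube of side `M` containing the site) and is an ISOMETRY from the lattice
distance `Site.tdist` to the periodic ℓ¹ length `pl1`. [cite: Balaban1987RG1, (0.1) p.251 and §0 p.257] -/
theorem exists_siteEquiv_pl1 (F : T3Family) (J : ℕ) {N M : ℕ} (h : (F.P J).sitesPerDir 0 = N * M) :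
    ∃ e : Site (F.P J) 0 ≃ TPt 3 (N * M),
      (∀ (x : Site (F.P J) 0) (i : Fin 3), (e x i).val = (x i).val) ∧
      ∀ x y : Site (F.P J) 0, (x.tdist y : ℝ) = pl1 (e x - e y) := by
  refine ⟨{ toFun := fun x i => ZMod.ringEquivCongr h (x i)
            invFun := fun p i => (ZMod.ringEquivCongr h).symm (p i)
            left_inv := fun x => by funext i; simp
            right_inv := fun p => by funext i; simp }, fun x i => ZMod.ringEquivCongr_val h (x i), fun x y => ?_⟩
  rw [pl1_eq_sum]
  unfold Site.tdist
  rw [Nat.cast_sum]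
  refine Finset.sum_congr rfl fun i _ => ?_
  change ((min (x i - y i).val (y i - x i).val : ℕ) : ℝ) = (pabs (ZMod.ringEquivCongr h (x i) - ZMod.ringEquivCongr h (y i)) : ℝ)
  -- transport along `ZMod.ringEquivCongr` preserves `valMinAbs` (the tree's `BIJ85Prop12TorusBridgeGeom.valMinAbs_ringEquivCongr`, re-derived
  -- locally to keep this file's import closure inside the R3 cone)
  have key : ∀ {a b : ℕ} (hab : a = b) (z : ZMod a), (ZMod.ringEquivCongr hab z).valMinAbs = z.valMinAbs := by
    intro a b hab z; subst hab; rw [ZMod.ringEquivCongr_refl_apply]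
  rw [pabs_eq_natAbs, ← map_sub, key, natAbs_valMinAbs_eq_min_val, neg_sub, Int.cast_natCast]

/-! ## §2 POLYᵗ∘ → POLYⁿ∘: group the cube terms by bond set, bound the bond-set diameter by the tree length, resum by (1.26) -/

/-- The `sup`-diameter of a bond set all of whose source cubes lie in a nonempty face-connected cube polymer `Y` is at most `3M·(d(Y) + 3)` (lit
✓`pl1_sub_le_torusTreeLen_sites` through the isometry `e`). [cite: Balaban1987RG1, §0 p.257] -/
theorem cast_supDiam_le_of_cubes_mem (F : T3Family) (J : ℕ) {N M : ℕ} [NeZero N] [NeZero M] (e : Site (F.P J) 0 ≃ TPt 3 (N * M))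
    (he : ∀ x y : Site (F.P J) 0, (x.tdist y : ℝ) = pl1 (e x - e y)) {Y : Finset (TPt 3 N)} (hY : Y.Nonempty) (hc : TFaceConnected Y)
    (X : Finset (PBond (F.P J) 0)) (hX : ∀ b ∈ X, tcubeOf N M (e b.src) ∈ Y) :
    ((X.sup fun a => X.sup fun a' => a.src.tdist a'.src : ℕ) : ℝ) ≤ (M : ℝ) * 3 * (torusTreeLen Y + 3) := by
  have hR : 0 ≤ (M : ℝ) * 3 * (torusTreeLen Y + 3) := by
    have := TreeLengthTorus.torusTreeLen_nonneg Y
    positivity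
  rcases X.eq_empty_or_nonempty with hXe | hXne
  · subst hXe; simpa using hR
  obtain ⟨a, ha, hsup⟩ := Finset.exists_mem_eq_sup X hXne (fun a => X.sup fun a' => a.src.tdist a'.src)
  obtain ⟨a', ha', hsup'⟩ := Finset.exists_mem_eq_sup X hXne (fun a' => a.src.tdist a'.src)
  rw [hsup, hsup', he]
  have h := pl1_sub_le_torusTreeLen_sites (d := 3) hY hc (hX a ha) (hX a' ha')
  simpa using h

/-- ★★★ **POLYᵗ∘ → POLYⁿ∘** — hypothesis = POLYᵗ∘ (per-polymer tree decay on `M`-cube polymers of the level-`J` torus, single scale; text above); conclusion = POLYⁿ∘ VERBATIM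
(the binder of ✓`…PolymerNormKnit.polymerCan_of_polymerNorm`) with `κⁿ := κ∕(2·M·3)` and `φ_J := A_J · exp(3κ∕2) · K₀(4·2³, 2·3)`.  Bond-set grouping
`T X := Σ_{Y : bs Y = X} T Y`, `w X := Σ_{Y : bs Y = X, Y face-connected} A_J e^{−κ d(Y)}`; locality∕oscillation∕representation by `Finset.sum_fiberwise`; the norm clause:
`b ∈ bs Y ⟺ tcubeOf N M (e b.src) ∈ Y`, `e^{κⁿ·tdiam(bs Y)} ≤ e^{(κ∕2)(d(Y)+3)}` (`cast_supDiam_le_of_cubes_mem`), then (1.26) at rate `κ∕2`.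
[cite: Balaban1988RG2Cluster, (1.26) p.8 and (2.29) p.18; Balaban1987RG1, Thm 1 p.259 and (0.24)-(0.25) p.257; Balaban1989LargeFieldII, (1.98)-(1.100) p.390] -/
theorem polymerNormCan_of_polymerTree
    (hT : ∀ (L : ℕ), ∃ pS : ℝ, ∀ (b₀ p₀ : ℝ), 0 < b₀ → pS ≤ p₀ → 0 < p₀ → ∃ ε₁ : ℝ, 0 < ε₁ ∧ ∀ (ε₀ : ℝ), 0 < ε₀ → ε₀ ≤ ε₁ →
      ∃ γ₁ : ℝ, 0 < γ₁ ∧ ∃ (M : ℕ) (_ : NeZero M), ∃ κ : ℝ, 0 < κ ∧ 2 * kappa₀ (4 * 2 ^ 3) (2 * 3) ≤ κ ∧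
        ∀ (F : T3Family) (γ : ℝ), F.L = L → 0 < γ → γ ≤ γ₁ →
        ∃ (A : ℕ → ℝ), (∀ J, 0 ≤ A J) ∧ (∀ a : ℕ, Tendsto (fun J : ℕ => ((J : ℝ) + 1) ^ a * A J) atTop (𝓝 0)) ∧
          ∀ (ν : ℕ → (j : ℕ) → Measure (GaugeField (F.P j) 0 (Matrix.specialUnitaryGroup (Fin 2) ℂ))),
            (∀ K, ν K K = T4GenFunBounds.gibbsMeasure (F.P K) ((F.scheme ℰp γ).β K)) →
            (∀ K j, j < K → ν K j = Measure.map (descend F ℰp j) (ν K (j + 1))) →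
            ∀ (J K : ℕ) (hJK : J ≤ K) (ρ : GaugeField (F.P J) 0 (Matrix.specialUnitaryGroup (Fin 2) ℂ) → ℝ),
              (∀ U, PlaqSmall (θBal F.L γ b₀ p₀ J) U → 0 < ρ U) →
              ν K J = (fieldMeasure _ _ _).withDensity (fun U => ENNReal.ofReal (ρ U)) →
              ContinuousOn ρ {U | PlaqSmall (θBal F.L γ b₀ p₀ J) U} →
              ∃ (N : ℕ) (_ : NeZero N) (e : Site (F.P J) 0 ≃ TPt 3 (N * M)),
                (∀ x y : Site (F.P J) 0, (x.tdist y : ℝ) = pl1 (e x - e y)) ∧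
                ∃ (c₀ : ℝ) (T : Finset (TPt 3 N) → GaugeField (F.P J) 0 (Matrix.specialUnitaryGroup (Fin 2) ℂ) → ℝ),
                  (∀ (Y : Finset (TPt 3 N)) (U V : GaugeField (F.P J) 0 (Matrix.specialUnitaryGroup (Fin 2) ℂ)),
                      (∀ b : PBond (F.P J) 0, tcubeOf N M (e b.src) ∈ Y → U b = V b) → T Y U = T Y V) ∧
                  (∀ Y : Finset (TPt 3 N), ¬ TFaceConnected Y → ∀ U : GaugeField (F.P J) 0 (Matrix.specialUnitaryGroup (Fin 2) ℂ), T Y U = 0) ∧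
                  (∀ (Y : Finset (TPt 3 N)) (b : PBond (F.P J) 0) (U V : GaugeField (F.P J) 0 (Matrix.specialUnitaryGroup (Fin 2) ℂ)),
                      PlaqSmall (θBal F.L γ b₀ p₀ J) U → PlaqSmall (θBal F.L γ b₀ p₀ J) V → (∀ e, e ≠ b → U e = V e) →
                      |T Y U - T Y V| ≤ A J * Real.exp (-κ * torusTreeLen Y)) ∧
                  (∀ U : GaugeField (F.P J) 0 (Matrix.specialUnitaryGroup (Fin 2) ℂ), PlaqSmall (θBal F.L γ b₀ p₀ J) U →
                      Real.log (ρ U) + (F.scheme ℰp γ).β K * minActionRegPr F J K hJK ε₀ U = c₀ + ∑ Y, T Y U)) :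
    ∀ (L : ℕ), ∃ pS : ℝ, ∀ (b₀ p₀ : ℝ), 0 < b₀ → pS ≤ p₀ → 0 < p₀ → ∃ ε₁ : ℝ, 0 < ε₁ ∧ ∀ (ε₀ : ℝ), 0 < ε₀ → ε₀ ≤ ε₁ →
      ∃ γ₁ : ℝ, 0 < γ₁ ∧ ∃ κ : ℝ, 0 < κ ∧ ∀ (F : T3Family) (γ : ℝ), F.L = L → 0 < γ → γ ≤ γ₁ →
        ∃ (φ : ℕ → ℝ), (∀ J, 0 ≤ φ J) ∧ (∀ a : ℕ, Tendsto (fun J : ℕ => ((J : ℝ) + 1) ^ a * φ J) atTop (𝓝 0)) ∧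
          ∀ (ν : ℕ → (j : ℕ) → Measure (GaugeField (F.P j) 0 (Matrix.specialUnitaryGroup (Fin 2) ℂ))),
            (∀ K, ν K K = T4GenFunBounds.gibbsMeasure (F.P K) ((F.scheme ℰp γ).β K)) →
            (∀ K j, j < K → ν K j = Measure.map (descend F ℰp j) (ν K (j + 1))) →
            ∀ (J K : ℕ) (hJK : J ≤ K) (ρ : GaugeField (F.P J) 0 (Matrix.specialUnitaryGroup (Fin 2) ℂ) → ℝ),
              (∀ U, PlaqSmall (θBal F.L γ b₀ p₀ J) U → 0 < ρ U) →
              ν K J = (fieldMeasure _ _ _).withDensity (fun U => ENNReal.ofReal (ρ U)) →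
              ContinuousOn ρ {U | PlaqSmall (θBal F.L γ b₀ p₀ J) U} →
              ∃ (c₀ : ℝ) (T : Finset (PBond (F.P J) 0) → GaugeField (F.P J) 0 (Matrix.specialUnitaryGroup (Fin 2) ℂ) → ℝ)
                (w : Finset (PBond (F.P J) 0) → ℝ),
                (∀ (X : Finset (PBond (F.P J) 0)) (U V : GaugeField (F.P J) 0 (Matrix.specialUnitaryGroup (Fin 2) ℂ)),
                    (∀ e ∈ X, U e = V e) → T X U = T X V) ∧
                (∀ (X : Finset (PBond (F.P J) 0)) (b : PBond (F.P J) 0) (U V : GaugeField (F.P J) 0 (Matrix.specialUnitaryGroup (Fin 2) ℂ)),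
                    PlaqSmall (θBal F.L γ b₀ p₀ J) U → PlaqSmall (θBal F.L γ b₀ p₀ J) V → (∀ e, e ≠ b → U e = V e) → |T X U - T X V| ≤ w X) ∧
                (∀ X : Finset (PBond (F.P J) 0), 0 ≤ w X) ∧
                (∀ b : PBond (F.P J) 0, ∑ X ∈ Finset.univ.filter (fun X => b ∈ X),
                    w X * Real.exp (κ * ((X.sup fun e => X.sup fun e' => e.src.tdist e'.src : ℕ) : ℝ)) ≤ φ J) ∧
                (∀ U : GaugeField (F.P J) 0 (Matrix.specialUnitaryGroup (Fin 2) ℂ), PlaqSmall (θBal F.L γ b₀ p₀ J) U →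
                    Real.log (ρ U) + (F.scheme ℰp γ).β K * minActionRegPr F J K hJK ε₀ U = c₀ + ∑ X, T X U) := by
  classical
  intro L
  obtain ⟨pS, HpS⟩ := hT L
  refine ⟨pS, ?_⟩
  intro b₀ p₀ hb₀ hpS hp₀
  obtain ⟨ε₁, hε₁, Hε⟩ := HpS b₀ p₀ hb₀ hpS hp₀
  refine ⟨ε₁, hε₁, ?_⟩
  intro ε₀ hε₀ hε₀₁
  obtain ⟨γ₁, hγ₁, M, instM, κ, hκ, hκ₀, HF⟩ := Hε ε₀ hε₀ hε₀₁
  have hM : (0 : ℝ) < M := by exact_mod_cast Nat.pos_of_neZero M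
  -- the constants of POLYⁿ∘
  set κn : ℝ := κ / (2 * M * 3) with hκn
  set C : ℝ := Real.exp (3 * (κ / 2)) * K₀ (4 * 2 ^ 3) (2 * 3) with hC
  have hCpos : 0 < C := mul_pos (Real.exp_pos _) (K₀_pos _ _)
  refine ⟨γ₁, hγ₁, κn, by positivity, ?_⟩
  intro F γ hFL hγ hγ₁'
  obtain ⟨A, hA0, hA, Hν⟩ := HF F γ hFL hγ hγ₁'
  refine ⟨fun J => A J * C, fun J => mul_nonneg (hA0 J) hCpos.le, fun a => ?_, ?_⟩
  · have := (hA a).mul_const C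
    simpa [mul_assoc] using this
  intro ν hνK hνd J K hJK ρ hρpos hρν hρcont
  obtain ⟨N, instN, e, he, c₀, T, hloc, hconn, hosc, hrep⟩ := Hν ν hνK hνd J K hJK ρ hρpos hρν hρcont
  -- bond set of a cube polymer and the weights
  set bs : Finset (TPt 3 N) → Finset (PBond (F.P J) 0) := fun Y => Finset.univ.filter (fun b => tcubeOf N M (e b.src) ∈ Y) with hbs
  set wY : Finset (TPt 3 N) → ℝ := fun Y => if TFaceConnected Y then A J * Real.exp (-κ * torusTreeLen Y) else 0 with hwY
  have hwY0 : ∀ Y, 0 ≤ wY Y := by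
    intro Y; simp only [hwY]; split_ifs
    · exact mul_nonneg (hA0 J) (Real.exp_nonneg _)
    · exact le_rfl
  have hoscY : ∀ Y (b : PBond (F.P J) 0) U V, PlaqSmall (θBal F.L γ b₀ p₀ J) U → PlaqSmall (θBal F.L γ b₀ p₀ J) V →
      (∀ e, e ≠ b → U e = V e) → |T Y U - T Y V| ≤ wY Y := by
    intro Y b U V hU hV hUV
    simp only [hwY]
    split_ifs with hcY
    · exact hosc Y b U V hU hV hUV
    · rw [hconn Y hcY U, hconn Y hcY V, sub_self, abs_zero]
  refine ⟨c₀, fun X U => ∑ Y ∈ Finset.univ.filter (fun Y => bs Y = X), T Y U,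
    fun X => ∑ Y ∈ Finset.univ.filter (fun Y => bs Y = X), wY Y, ?_, ?_, ?_, ?_, ?_⟩
  · -- (i) locality
    intro X U V hUV
    refine Finset.sum_congr rfl fun Y hY => ?_
    have hYX : bs Y = X := (Finset.mem_filter.mp hY).2
    refine hloc Y U V fun b hb => hUV b ?_
    rw [← hYX]
    exact Finset.mem_filter.mpr ⟨Finset.mem_univ _, hb⟩
  · -- (ii) one-bond window oscillation
    intro X b U V hU hV hUV
    rw [← Finset.sum_sub_distrib]
    exact (Finset.abs_sum_le_sum_abs _ _).trans (Finset.sum_le_sum fun Y _ => hoscY Y b U V hU hV hUV)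
  · -- (iii') non-negativity
    intro X
    exact Finset.sum_nonneg fun Y _ => hwY0 Y
  · -- (iv') the polymer-norm clause
    intro b
    -- regroup by cube polymer
    have hgroup : ∑ X ∈ Finset.univ.filter (fun X => b ∈ X),
        (∑ Y ∈ Finset.univ.filter (fun Y => bs Y = X), wY Y) *
          Real.exp (κn * ((X.sup fun e => X.sup fun e' => e.src.tdist e'.src : ℕ) : ℝ))
        = ∑ Y ∈ Finset.univ.filter (fun Y => bs Y ∈ Finset.univ.filter (fun X => b ∈ X)),
            wY Y * Real.exp (κn * (((bs Y).sup fun e => (bs Y).sup fun e' => e.src.tdist e'.src : ℕ) : ℝ)) := by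
      rw [← Finset.sum_fiberwise_eq_sum_filter Finset.univ (Finset.univ.filter (fun X => b ∈ X)) bs]
      refine Finset.sum_congr rfl fun X _ => ?_
      rw [Finset.sum_mul]
      refine Finset.sum_congr rfl fun Y hY => ?_
      rw [(Finset.mem_filter.mp hY).2]
    rw [hgroup]
    -- termwise: only face-connected polymers through the cube of `b.src` contribute, each at most `A_J e^{3κ/2} e^{−(κ/2) d(Y)}`
    have hmem : ∀ Y, bs Y ∈ Finset.univ.filter (fun X => b ∈ X) ↔ tcubeOf N M (e b.src) ∈ Y := by
      intro Y
      simp only [Finset.mem_filter, Finset.mem_univ, true_and, hbs]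
    have hpt : ∀ Y ∈ Finset.univ.filter (fun Y => bs Y ∈ Finset.univ.filter (fun X => b ∈ X)),
        wY Y * Real.exp (κn * (((bs Y).sup fun e => (bs Y).sup fun e' => e.src.tdist e'.src : ℕ) : ℝ))
          ≤ if tcubeOf N M (e b.src) ∈ Y ∧ TFaceConnected Y then A J * Real.exp (3 * (κ / 2)) * Real.exp (-(κ / 2) * torusTreeLen Y) else 0 := by
      intro Y hY
      have hcb : tcubeOf N M (e b.src) ∈ Y := (hmem Y).mp (Finset.mem_filter.mp hY).2
      by_cases hcY : TFaceConnected Y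
      · rw [if_pos ⟨hcb, hcY⟩]
        simp only [hwY, if_pos hcY]
        have hdiam := cast_supDiam_le_of_cubes_mem F J e he ⟨_, hcb⟩ hcY (bs Y)
          (fun b' hb' => (Finset.mem_filter.mp hb').2)
        have hexp : Real.exp (κn * (((bs Y).sup fun e => (bs Y).sup fun e' => e.src.tdist e'.src : ℕ) : ℝ))
            ≤ Real.exp ((κ / 2) * (torusTreeLen Y + 3)) := by
          refine Real.exp_le_exp.mpr ?_
          have hκn0 : 0 ≤ κn := by positivity
          calc κn * (((bs Y).sup fun e => (bs Y).sup fun e' => e.src.tdist e'.src : ℕ) : ℝ)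
              ≤ κn * ((M : ℝ) * 3 * (torusTreeLen Y + 3)) := mul_le_mul_of_nonneg_left hdiam hκn0
            _ = (κ / 2) * (torusTreeLen Y + 3) := by rw [hκn]; field_simp
        calc A J * Real.exp (-κ * torusTreeLen Y) * Real.exp (κn * (((bs Y).sup fun e => (bs Y).sup fun e' => e.src.tdist e'.src : ℕ) : ℝ))
            ≤ A J * Real.exp (-κ * torusTreeLen Y) * Real.exp ((κ / 2) * (torusTreeLen Y + 3)) :=
              mul_le_mul_of_nonneg_left hexp (mul_nonneg (hA0 J) (Real.exp_nonneg _))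
          _ = A J * Real.exp (3 * (κ / 2)) * Real.exp (-(κ / 2) * torusTreeLen Y) := by
              have hsplit : Real.exp (-κ * torusTreeLen Y) * Real.exp ((κ / 2) * (torusTreeLen Y + 3))
                  = Real.exp (3 * (κ / 2)) * Real.exp (-(κ / 2) * torusTreeLen Y) := by
                rw [← Real.exp_add, ← Real.exp_add]
                congr 1
                ring
              rw [mul_assoc, hsplit, ← mul_assoc]
      · rw [if_neg (fun h => hcY h.2)]
        simp only [hwY, if_neg hcY, zero_mul, le_refl]
    refine (Finset.sum_le_sum hpt).trans ?_
    rw [← Finset.sum_filter, Finset.filter_filter]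
    -- the surviving family is exactly the one-point family of (1.26) at the cube of `b.src`
    have hfam : Finset.univ.filter (fun Y => bs Y ∈ Finset.univ.filter (fun X => b ∈ X) ∧ (tcubeOf N M (e b.src) ∈ Y ∧ TFaceConnected Y))
        = Finset.univ.filter (fun Y => tcubeOf N M (e b.src) ∈ Y ∧ TFaceConnected Y) := by
      refine Finset.filter_congr fun Y _ => ?_
      rw [hmem Y]
      tauto
    rw [hfam, ← Finset.mul_sum]
    have hκ2 : kappa₀ (4 * 2 ^ 3) (2 * 3) ≤ κ / 2 := by
      have h2 := hκ₀
      set q : ℝ := kappa₀ (4 * 2 ^ 3) (2 * 3)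
      linarith
    have hone := sum_exp_torusTreeLen_le 3 N (tcubeOf N M (e b.src)) hκ2
    calc A J * Real.exp (3 * (κ / 2)) * ∑ Y ∈ Finset.univ.filter (fun Y => tcubeOf N M (e b.src) ∈ Y ∧ TFaceConnected Y),
          Real.exp (-(κ / 2) * torusTreeLen Y)
        ≤ A J * Real.exp (3 * (κ / 2)) * K₀ (4 * 2 ^ 3) (2 * 3) :=
          mul_le_mul_of_nonneg_left hone (mul_nonneg (hA0 J) (Real.exp_nonneg _))
      _ = A J * C := by rw [hC, mul_assoc]
  · -- (v) representation
    intro U hU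
    rw [hrep U hU, Finset.sum_fiberwise Finset.univ bs (fun Y => T Y U)]

/-! ## §3 POLYᵗ∘ → S2β and POLYᵗ∘ → GRAD∘ (compositions with ✓`…PolymerNormKnit`) -/

/-- ★★★ **POLYᵗ∘ → S2β**: the PATH-B organ S2β `FluctuationPartSmall` (registry `Lines/semiclassical_s2beta.lean` v11.4 §2 :412) VERBATIM from the lattice-animal edition POLYᵗ∘
(per-polymer tree decay of the localized fluctuation part on `M`-cube polymers of the level-`J` torus), via POLYⁿ∘ (§2) and ✓`fluctuationPartSmall_of_polymerNorm`.
[cite: Balaban1988RG2Cluster, (1.26) p.8; Balaban1987RG1, Thm 1 p.259 and (0.24)-(0.25) p.257; Balaban1989LargeFieldII, (1.98)-(1.100) p.390; Balaban1985UV3, Thm 2 p.263 and (41) p.266] -/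
theorem fluctuationPartSmall_of_polymerTree
    (hT : ∀ (L : ℕ), ∃ pS : ℝ, ∀ (b₀ p₀ : ℝ), 0 < b₀ → pS ≤ p₀ → 0 < p₀ → ∃ ε₁ : ℝ, 0 < ε₁ ∧ ∀ (ε₀ : ℝ), 0 < ε₀ → ε₀ ≤ ε₁ →
      ∃ γ₁ : ℝ, 0 < γ₁ ∧ ∃ (M : ℕ) (_ : NeZero M), ∃ κ : ℝ, 0 < κ ∧ 2 * kappa₀ (4 * 2 ^ 3) (2 * 3) ≤ κ ∧
        ∀ (F : T3Family) (γ : ℝ), F.L = L → 0 < γ → γ ≤ γ₁ →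
        ∃ (A : ℕ → ℝ), (∀ J, 0 ≤ A J) ∧ (∀ a : ℕ, Tendsto (fun J : ℕ => ((J : ℝ) + 1) ^ a * A J) atTop (𝓝 0)) ∧
          ∀ (ν : ℕ → (j : ℕ) → Measure (GaugeField (F.P j) 0 (Matrix.specialUnitaryGroup (Fin 2) ℂ))),
            (∀ K, ν K K = T4GenFunBounds.gibbsMeasure (F.P K) ((F.scheme ℰp γ).β K)) →
            (∀ K j, j < K → ν K j = Measure.map (descend F ℰp j) (ν K (j + 1))) →
            ∀ (J K : ℕ) (hJK : J ≤ K) (ρ : GaugeField (F.P J) 0 (Matrix.specialUnitaryGroup (Fin 2) ℂ) → ℝ),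
              (∀ U, PlaqSmall (θBal F.L γ b₀ p₀ J) U → 0 < ρ U) →
              ν K J = (fieldMeasure _ _ _).withDensity (fun U => ENNReal.ofReal (ρ U)) →
              ContinuousOn ρ {U | PlaqSmall (θBal F.L γ b₀ p₀ J) U} →
              ∃ (N : ℕ) (_ : NeZero N) (e : Site (F.P J) 0 ≃ TPt 3 (N * M)),
                (∀ x y : Site (F.P J) 0, (x.tdist y : ℝ) = pl1 (e x - e y)) ∧
                ∃ (c₀ : ℝ) (T : Finset (TPt 3 N) → GaugeField (F.P J) 0 (Matrix.specialUnitaryGroup (Fin 2) ℂ) → ℝ),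
                  (∀ (Y : Finset (TPt 3 N)) (U V : GaugeField (F.P J) 0 (Matrix.specialUnitaryGroup (Fin 2) ℂ)),
                      (∀ b : PBond (F.P J) 0, tcubeOf N M (e b.src) ∈ Y → U b = V b) → T Y U = T Y V) ∧
                  (∀ Y : Finset (TPt 3 N), ¬ TFaceConnected Y → ∀ U : GaugeField (F.P J) 0 (Matrix.specialUnitaryGroup (Fin 2) ℂ), T Y U = 0) ∧
                  (∀ (Y : Finset (TPt 3 N)) (b : PBond (F.P J) 0) (U V : GaugeField (F.P J) 0 (Matrix.specialUnitaryGroup (Fin 2) ℂ)),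
                      PlaqSmall (θBal F.L γ b₀ p₀ J) U → PlaqSmall (θBal F.L γ b₀ p₀ J) V → (∀ e, e ≠ b → U e = V e) →
                      |T Y U - T Y V| ≤ A J * Real.exp (-κ * torusTreeLen Y)) ∧
                  (∀ U : GaugeField (F.P J) 0 (Matrix.specialUnitaryGroup (Fin 2) ℂ), PlaqSmall (θBal F.L γ b₀ p₀ J) U →
                      Real.log (ρ U) + (F.scheme ℰp γ).β K * minActionRegPr F J K hJK ε₀ U = c₀ + ∑ Y, T Y U)) :
    ∀ (L : ℕ), ∃ pS : ℝ, ∀ (b₀ p₀ : ℝ), 0 < b₀ → pS ≤ p₀ → 0 < p₀ → ∃ ε₁ : ℝ, 0 < ε₁ ∧ ∀ (ε₀ : ℝ), 0 < ε₀ → ε₀ ≤ ε₁ →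
      ∃ γ₁ : ℝ, 0 < γ₁ ∧ ∃ κ : ℝ, 0 < κ ∧ ∀ (F : T3Family) (γ : ℝ), F.L = L → 0 < γ → γ ≤ γ₁ →
        ∃ (φ : ℕ → ℝ), (∀ J, 0 ≤ φ J) ∧ Tendsto (fun J : ℕ => (J : ℝ) * φ J) atTop (𝓝 0) ∧
          ∀ (ν : ℕ → (j : ℕ) → Measure (GaugeField (F.P j) 0 (Matrix.specialUnitaryGroup (Fin 2) ℂ))),
            (∀ K, ν K K = T4GenFunBounds.gibbsMeasure (F.P K) ((F.scheme ℰp γ).β K)) →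
            (∀ K j, j < K → ν K j = Measure.map (descend F ℰp j) (ν K (j + 1))) →
            ∀ (J K : ℕ) (hJK : J ≤ K) (ρ : GaugeField (F.P J) 0 (Matrix.specialUnitaryGroup (Fin 2) ℂ) → ℝ),
              (∀ U, PlaqSmall (θBal F.L γ b₀ p₀ J) U → 0 < ρ U) →
              ν K J = (fieldMeasure _ _ _).withDensity (fun U => ENNReal.ofReal (ρ U)) →
              ContinuousOn ρ {U | PlaqSmall (θBal F.L γ b₀ p₀ J) U} →
              ∀ (b b' : PBond (F.P J) 0) (U V W Z : GaugeField (F.P J) 0 (Matrix.specialUnitaryGroup (Fin 2) ℂ)),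
                PlaqSmall (θBal F.L γ b₀ p₀ J) U → PlaqSmall (θBal F.L γ b₀ p₀ J) V →
                PlaqSmall (θBal F.L γ b₀ p₀ J) W → PlaqSmall (θBal F.L γ b₀ p₀ J) Z →
                (∀ e, e ≠ b → U e = V e) → (∀ e, e ≠ b' → U e = W e) → (∀ e, e ≠ b' → V e = Z e) → (∀ e, e ≠ b → W e = Z e) →
                |((Real.log (ρ U) + (F.scheme ℰp γ).β K * minActionRegPr F J K hJK ε₀ U)
                    - (Real.log (ρ V) + (F.scheme ℰp γ).β K * minActionRegPr F J K hJK ε₀ V))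
                  - ((Real.log (ρ W) + (F.scheme ℰp γ).β K * minActionRegPr F J K hJK ε₀ W)
                    - (Real.log (ρ Z) + (F.scheme ℰp γ).β K * minActionRegPr F J K hJK ε₀ Z))|
                  ≤ φ J * Real.exp (-(κ * (b.src.tdist b'.src : ℝ))) :=
  fluctuationPartSmall_of_polymerNorm (polymerNormCan_of_polymerTree hT)

/-- ★★★ **POLYᵗ∘ → GRAD∘**: LINE g24-1's first-order row GRAD∘ `OneBondOscillationCan` VERBATIM from POLYᵗ∘, via POLYⁿ∘ (§2) and ✓`oneBondOscillation_of_polymerNorm`.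
[cite: Balaban1988RG2Cluster, (1.26) p.8; Balaban1987RG1, Thm 1 p.259 and (0.24)-(0.25) p.257; Balaban1989LargeFieldII, (1.98)-(1.100) p.390] -/
theorem oneBondOscillation_of_polymerTree
    (hT : ∀ (L : ℕ), ∃ pS : ℝ, ∀ (b₀ p₀ : ℝ), 0 < b₀ → pS ≤ p₀ → 0 < p₀ → ∃ ε₁ : ℝ, 0 < ε₁ ∧ ∀ (ε₀ : ℝ), 0 < ε₀ → ε₀ ≤ ε₁ →
      ∃ γ₁ : ℝ, 0 < γ₁ ∧ ∃ (M : ℕ) (_ : NeZero M), ∃ κ : ℝ, 0 < κ ∧ 2 * kappa₀ (4 * 2 ^ 3) (2 * 3) ≤ κ ∧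
        ∀ (F : T3Family) (γ : ℝ), F.L = L → 0 < γ → γ ≤ γ₁ →
        ∃ (A : ℕ → ℝ), (∀ J, 0 ≤ A J) ∧ (∀ a : ℕ, Tendsto (fun J : ℕ => ((J : ℝ) + 1) ^ a * A J) atTop (𝓝 0)) ∧
          ∀ (ν : ℕ → (j : ℕ) → Measure (GaugeField (F.P j) 0 (Matrix.specialUnitaryGroup (Fin 2) ℂ))),
            (∀ K, ν K K = T4GenFunBounds.gibbsMeasure (F.P K) ((F.scheme ℰp γ).β K)) →
            (∀ K j, j < K → ν K j = Measure.map (descend F ℰp j) (ν K (j + 1))) →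
            ∀ (J K : ℕ) (hJK : J ≤ K) (ρ : GaugeField (F.P J) 0 (Matrix.specialUnitaryGroup (Fin 2) ℂ) → ℝ),
              (∀ U, PlaqSmall (θBal F.L γ b₀ p₀ J) U → 0 < ρ U) →
              ν K J = (fieldMeasure _ _ _).withDensity (fun U => ENNReal.ofReal (ρ U)) →
              ContinuousOn ρ {U | PlaqSmall (θBal F.L γ b₀ p₀ J) U} →
              ∃ (N : ℕ) (_ : NeZero N) (e : Site (F.P J) 0 ≃ TPt 3 (N * M)),
                (∀ x y : Site (F.P J) 0, (x.tdist y : ℝ) = pl1 (e x - e y)) ∧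
                ∃ (c₀ : ℝ) (T : Finset (TPt 3 N) → GaugeField (F.P J) 0 (Matrix.specialUnitaryGroup (Fin 2) ℂ) → ℝ),
                  (∀ (Y : Finset (TPt 3 N)) (U V : GaugeField (F.P J) 0 (Matrix.specialUnitaryGroup (Fin 2) ℂ)),
                      (∀ b : PBond (F.P J) 0, tcubeOf N M (e b.src) ∈ Y → U b = V b) → T Y U = T Y V) ∧
                  (∀ Y : Finset (TPt 3 N), ¬ TFaceConnected Y → ∀ U : GaugeField (F.P J) 0 (Matrix.specialUnitaryGroup (Fin 2) ℂ), T Y U = 0) ∧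
                  (∀ (Y : Finset (TPt 3 N)) (b : PBond (F.P J) 0) (U V : GaugeField (F.P J) 0 (Matrix.specialUnitaryGroup (Fin 2) ℂ)),
                      PlaqSmall (θBal F.L γ b₀ p₀ J) U → PlaqSmall (θBal F.L γ b₀ p₀ J) V → (∀ e, e ≠ b → U e = V e) →
                      |T Y U - T Y V| ≤ A J * Real.exp (-κ * torusTreeLen Y)) ∧
                  (∀ U : GaugeField (F.P J) 0 (Matrix.specialUnitaryGroup (Fin 2) ℂ), PlaqSmall (θBal F.L γ b₀ p₀ J) U →
                      Real.log (ρ U) + (F.scheme ℰp γ).β K * minActionRegPr F J K hJK ε₀ U = c₀ + ∑ Y, T Y U)) :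
    ∀ (L : ℕ), ∃ pS : ℝ, ∀ (b₀ p₀ : ℝ), 0 < b₀ → pS ≤ p₀ → 0 < p₀ → ∃ ε₁ : ℝ, 0 < ε₁ ∧ ∀ (ε₀ : ℝ), 0 < ε₀ → ε₀ ≤ ε₁ →
      ∃ γ₁ : ℝ, 0 < γ₁ ∧ ∀ (F : T3Family) (γ : ℝ), F.L = L → 0 < γ → γ ≤ γ₁ →
        ∃ (σ : ℕ → ℝ), (∀ J, 0 ≤ σ J) ∧ (∀ a : ℕ, Tendsto (fun J : ℕ => ((J : ℝ) + 1) ^ a * σ J) atTop (𝓝 0)) ∧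
          ∀ (ν : ℕ → (j : ℕ) → Measure (GaugeField (F.P j) 0 (Matrix.specialUnitaryGroup (Fin 2) ℂ))),
            (∀ K, ν K K = T4GenFunBounds.gibbsMeasure (F.P K) ((F.scheme ℰp γ).β K)) →
            (∀ K j, j < K → ν K j = Measure.map (descend F ℰp j) (ν K (j + 1))) →
            ∀ (J K : ℕ) (hJK : J ≤ K) (ρ : GaugeField (F.P J) 0 (Matrix.specialUnitaryGroup (Fin 2) ℂ) → ℝ),
              (∀ U, PlaqSmall (θBal F.L γ b₀ p₀ J) U → 0 < ρ U) →
              ν K J = (fieldMeasure _ _ _).withDensity (fun U => ENNReal.ofReal (ρ U)) →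
              ContinuousOn ρ {U | PlaqSmall (θBal F.L γ b₀ p₀ J) U} →
              ∀ (b : PBond (F.P J) 0) (U V : GaugeField (F.P J) 0 (Matrix.specialUnitaryGroup (Fin 2) ℂ)),
                PlaqSmall (θBal F.L γ b₀ p₀ J) U → PlaqSmall (θBal F.L γ b₀ p₀ J) V →
                (∀ e, e ≠ b → U e = V e) →
                |(Real.log (ρ U) + (F.scheme ℰp γ).β K * minActionRegPr F J K hJK ε₀ U)
                    - (Real.log (ρ V) + (F.scheme ℰp γ).β K * minActionRegPr F J K hJK ε₀ V)| ≤ σ J :=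
  oneBondOscillation_of_polymerNorm (polymerNormCan_of_polymerTree hT)

end Summit.QuantumFields.YangMills.Theorems.FluctuationComparisonRegPrIntLPolymerTreeKnit

end
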